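import Mathlib
import Literature.MathematicalPhysics.QuantumFieldTheory.Balaban1983to89.B12BetaSmooth

/-!
# `Balaban1983to89.B12BetaHolo` — the p. 264 β-clause of [Balaban1987RG1] («smooth … (or analytic), uniformly bounded on
# [0, γ] together with all derivatives») KERNEL-DERIVED in the «(or analytic)» alternative of p. 266 from holomorphy in the
# coupling of the vacuum-polarization kernel with (5.10) on a complex neighbourhood of [0, γ]

T. Bałaban, *Renormalization group approach to lattice gauge field theories. I. Generation of effective actions in a small
field approximation and a coupling constant renormalization in four dimensions*, Commun. Math. Phys. **109** (1987) 249–301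
[Balaban1987RG1] (cell paper B12 = «[I]»; PDF page = journal page − 248).  TRACK A (YM-PLAN §2b), DAG node N09 = `Dag.B12_main`,
seat `pub-ymgap-dag-n09-a` (KNIT-BY-NAME, generation g2).  Satellite of `…B12BetaSmooth` (surge node b2b-balaban-pv20) and of
`…B12StepObligation`; nothing landed is modified.

## WHAT PRINT SAYS (verbatim) and what the tree had

* p. 264 [PDF 16], of `β_{j+1}` after (1.20)–(1.22): *«It is a smooth function defined on the interval [0, γ], (or analytic),
  uniformly bounded on this interval together with all derivatives. We will investigate other properties in a separate paper.»* —
  ASSERTED in the inductive description, proved NEITHER in §§2–5 of [I] nor in [II] (cell GAPS G-b12-2 (ii), G-adv2-3, G-adv2-6);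
  in the tree it is the ONE unsourced per-step hypothesis `B12StepObligation.BetaSmoothAt` of the Theorem-3 step obligation
  (`sfNewTerm_of_bound`), hence of conjunct 2 of node N09 (`B12NodeKnit.b12_main_of_up_frameOf_of_deliverables`, input `hsmooth`;
  (iv′) `…_analytic`, input `han : BetaAnalyticAt`).
* p. 266 [PDF 18], after (2.9): *«Another possibility is to take g_k/γ_k ε₁ instead of ε₁, where γ_k = C log(L^k ε)^{−1} with C
  sufficiently large. It has the advantage that the functions E^{(j)}, β_j are analytic functions of the effective coupling
  constants, but it has some disadvantages in perturbative calculations also. We have formulated the implications of both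
  possibilities in the inductive description.»* — the «(or analytic)» ALTERNATIVE.
* (1.20)–(1.22) p. 264: `Π^{ab}_{j+1,μν}(g_j, x, x′) = (δ²/δB δB 𝐄^{(j+1)})(g_j, 0)`, the limit `T^{(j+1)} ↗ ℤ^d` (*«This limit
  exists by the localized representation (1.7).»*), `β_{j+1}(g_j) = Σ_x Π_{j+1,μν}(g_j, x) x_μ x_ν` (= (5.42) p. 297 *«the fundamental
  equality defining the β-function»*); (5.10) p. 293: *«∣Π_{μν}(x − y)∣ ≤ O(1)E₀ exp(−δ₁∣x − y∣)»*.
* Tree before this module: `B12BetaSmooth` reduces the β-clause to the LOCATED Π-input `PiSmoothSource` (g-smoothness of the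
  kernel with (5.10)-type decay of EVERY g-derivative, constants `Cₙ` free) by differentiation under the lattice sum (1.22), and
  names the passage from the terms `E^{(j)}` to that input as the UNTYPED hypothesis `PolarizationDerivTransfer`.

## WHAT THIS MODULE PROVES (0 sorry; axioms {propext, Classical.choice, Quot.sound})

The standard complex-analytic mechanism behind p. 266's sentence, kernel-checked, in two layers.

* Part 1 (pure complex analysis, no tower).  For `F : ℂ → ℂ` holomorphic on an open `U ⊆ ℂ` containing the real segment
  `[a, b]`: the real trace `t ↦ Re F(t)` is `C^∞` and real-analytic on `[a, b]`; its `n`-th derivative WITHIN `[a, b]` (the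
  one-sided currency of `Step.SFHyp.betaSmooth` ∕ `BetaDerivBoundsAt`) is `Re F^{(n)}(t)` (`iteratedDerivWithin_Icc_eq`); and if
  `U` contains the closed discs of radius `r` about the points of `[a, b]` and `‖F‖ ≤ M` on `U`, CAUCHY'S ESTIMATE gives
  `|∂ⁿ_t Re F(t)| ≤ n! · M · r⁻ⁿ` on `[a, b]` (`abs_iteratedDerivWithin_Icc_le`; Mathlib
  `Complex.norm_iteratedDeriv_le_of_forall_mem_sphere_norm_le`).  A dominated lattice sum `Σ_x P(g, x) x_μ x_ν` of kernels
  holomorphic in `g` with `‖P(g, x)‖ ≤ C e^{−δ₁|x|₁}` on `U` is holomorphic on `U` and bounded by `B12Sec2to5.betaPrime510 d C δ₁ =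
  C Σ_x |x|₁² e^{−δ₁|x|₁}` there (`differentiableOn_momentC`, `norm_momentC_le`; Mathlib `Complex.differentiableOn_tsum_of_summable_norm`).
* Part 2 (tower level).  `PiHoloSource T c k`: the §5 source `Beta542Source` ((5.42): `β_{k+1}(g)` = second moment of a real
  kernel family `Pk g`; `B12Sec2to5.betaPrime510 ≤ β′`) whose `(μ, ν)`-component is, on `[0, γ]`, the real part of a kernel `Pc(g, x)`
  HOLOMORPHIC in `g` on an open `U ⊇ [0, γ]` with a uniform margin `r` and obeying (5.10) ON `U`: `‖Pc(g, x)‖ ≤ C e^{−δ₁|x|₁}`.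
  THEN (all kernel-checked): `Beta542Source T c k` (`toBeta542Source`); `B12BetaSmooth.PiSmoothSource T c k` with the EXPLICIT
  derivative constants `Cₙ = n! · C · r⁻ⁿ` (`toPiSmoothSource`) — so `BetaSmoothAt` (the unsourced clause), `BetaDerivBoundsAt`
  with `β′ₙ = n! · r⁻ⁿ · B12Sec2to5.betaPrime510 d C δ₁` («uniformly bounded on this interval together with all derivatives», the bound being
  UNIFORM IN `k` exactly when `C, δ₁, r, d` are — `betaDerivBounds`), `|β_{k+1}| ≤ β′` (`betaBound`); AND `B12BetaSmooth.BetaAnalyticAt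
  T c k` (`betaAnalyticAt`: `β_{k+1}` is the real trace of the holomorphic `Σ_x Pc(g, x) x_μ x_ν`).  Corollary `sfNewTerm_of_bound_piHolo`:
  the per-step deliverable `Step.SFNewTerm T c k` assembled by `B12StepObligation.sfNewTerm_of_bound` with BOTH β-clauses supplied
  by ONE holomorphic Π-source.  `exists_margin`: the uniform margin `r` exists for every open `U ⊇ [0, γ]` (compactness), so it is
  bookkeeping, not an assumption.

The passage from the TERMS `𝐄^{(k+1)}(X, g, ·)` — jointly holomorphic in `(g, 𝐀)` with (1.18) on `U ×` (4.4), which is what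
p. 266's «E^{(j)} … analytic functions of the effective coupling constants» provides — through (1.20) = (4.35)∕(4.37) and the
limit (1.21) to such a `Pc` (i.e. `B12BetaSmooth.PolarizationDerivTransfer` in holomorphic currency) is the companion module
`…B12PolarizationHolo` (finite volume by `B12Decay510`'s polymer sum in norm form; the limit by VITALI's theorem from convergence at
REAL couplings).

HONEST FRAMING.  Count-neutral Literature theorems: NODE 00's Stage-5∕8 construction of record (`βfun` = `secondMoment (polLimit …)`,
seat n09-b's STAGE8-BETA-SCOPING) is what will INSTANTIATE `PiHoloSource`; until then nothing of N09's statement of record is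
discharged by this file.  The module does NOT source the β-clause in print: it DERIVES it, in the «(or analytic)» reading only, from
holomorphy-in-g inputs on Π (here) ∕ on `E^{(j)}` (companion) that [I]∕[II] formulate (p. 266) but do not prove; the SIGN of β
(asymptotic freedom, NODE O) is untouched.  One finite four-torus programme at fixed ε; NOT ℝ⁴, NOT infinite volume, NOT OS axioms,
NOT a mass gap, NOT the Clay problem.
v2 (append-only; v1 declarations byte-identical): Part 3 — the p. 263 clause ON THE TERMS at the new index (*«It is a C^∞-function of
g_{j−1} ∈ [0, γ], (or analytic)»*) in the same currency: `EHoloAt T c k` (the new term `E^{(k+1)}(X, g, φ)` is, for `g ∈ [0, γ]` and `φ`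
in the analyticity domain, the trace of a function HOLOMORPHIC in `g` on `U` with (1.18) ON `U`) ⇒ `B12BetaSmooth.EAnalyticAt` (`eAnalyticAt`),
`B12BetaSmooth.ESmoothAt` (`eSmoothAt`), and the new-index slice of the located open input `B12BetaSmooth.EDerivBound118` with the EXPLICIT
constants `E₀,ₙ = n! · E₀ · r⁻ⁿ` (`eDerivBoundAt`, Cauchy), plus the cumulative step `eDerivBound118_succ`.  So BOTH located inputs of
`B12BetaSmooth` (Part 1's `EDerivBound118`, Part 2's `PiSmoothSource`) are theorems in the «(or analytic)» alternative.
v3 (append-only; v1∕v2 declarations byte-identical): Part 4 — the NAMED Prop `B12BetaSmooth.PolarizationDerivTransfer T c E₀n k` ITSELF holds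
for every tower step carrying a holomorphic Π-source (`polarizationDerivTransfer_of_piHolo`: its conclusion `Nonempty (PiSmoothSource T c k)` is
`toPiSmoothSource`, for all `E₀n`), so that `B12BetaSmooth.betaClauses_of_transfer` applies verbatim; and the Markov-typing continuity ∕ Lipschitz
forms of the β-clause on `[0, γ]` that the flow step consumes (`betaContinuousOn`, `betaLipschitzOn`: `|β_{k+1}(g) − β_{k+1}(g′)| ≤ (betaPrime510 d C
δ₁ ∕ r)·|g − g′|`).  WORDING (referee ref-C READ #35): the companion `B12PolarizationHolo` proves the analytic-currency ANALOGUE of the transfer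
(leaves ⇒ `PiHoloSource`); the named Prop is obtained from it only through Part 4 here.
v4 (append-only; v1–v3 declarations byte-identical): Part 5 — THE ENDPOINT g = 0 BY CONTINUITY (cell item TS-3 endpoint; dag-n23-a's probe
shape): [II] delivers its clauses at the couplings `g ∈ ]0, γ]` (Lemma 2 needs `g ≠ 0`), while the inductive clause (1.18) is typed on the CLOSED
`[0, γ]` (p. 263 «g_{j−1} ∈ [0, γ]»); `bound118_Icc_of_Ioc`: a g-uniform bound on `]0, γ]` + continuity of `g ↦ E^{(k+1)}(X, g, φ)` at `0` within
`[0, γ]` (supplied by `EHoloAt`, `EHoloAt.continuousWithinAt`) ⇒ the bound on `[0, γ]`; hence `sfNewTerm_of_deliverables_Ioc`: the per-step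
deliverable `Step.SFNewTerm T c k` from [II]'s deliverables on `]0, γ]` ONLY + `EHoloAt` + `PiHoloSource` (+ dictionary, (2.15), p. 263) — no
separate g = 0 datum.
-/

noncomputable section

open Set Filter Metric Topology Complex

namespace Literature.MathematicalPhysics.QuantumFieldTheory.Balaban1983to89.B12BetaHolo

open Literature.MathematicalPhysics.QuantumFieldTheory.Balaban1983to89
open Literature.MathematicalPhysics.QuantumFieldTheory.Balaban1983to89.Step
open Literature.MathematicalPhysics.QuantumFieldTheory.Balaban1983to89.B12StepObligation
open Literature.MathematicalPhysics.QuantumFieldTheory.Balaban1983to89.B12BetaSmooth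

/-! ## Part 1a. The real trace of a holomorphic function: smoothness, within-`[a, b]` derivatives, Cauchy bounds -/

section RealTrace

variable {U : Set ℂ} {F : ℂ → ℂ}

/-- The successive complex derivatives of a function holomorphic on an open set are holomorphic there. [folklore] -/
private theorem differentiableOn_iteratedDeriv (hU : IsOpen U) (hF : DifferentiableOn ℂ F U) (n : ℕ) :
    DifferentiableOn ℂ (iteratedDeriv n F) U := by
  rw [iteratedDeriv_eq_iterate]
  exact ((hF.analyticOnNhd hU).iterated_deriv n).differentiableOn

/-- The real trace `t ↦ Re F^{(n)}(t)` has derivative `Re F^{(n+1)}(t)` at every real point of `U`. [folklore] -/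
private theorem hasDerivAt_re_iteratedDeriv (hU : IsOpen U) (hF : DifferentiableOn ℂ F U) (n : ℕ) {t : ℝ}
    (ht : (t : ℂ) ∈ U) :
    HasDerivAt (fun s : ℝ => (iteratedDeriv n F s).re) (iteratedDeriv (n + 1) F t).re t := by
  have h1 : HasDerivAt (iteratedDeriv n F) (deriv (iteratedDeriv n F) t) t :=
    ((differentiableOn_iteratedDeriv hU hF n).differentiableAt (hU.mem_nhds ht)).hasDerivAt
  rw [iteratedDeriv_succ]
  exact h1.real_of_complex

/-- On the (open) real trace of `U`, the `n`-th real derivative of `t ↦ Re F(t)` is `Re F^{(n)}(t)`. [folklore] -/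
private theorem iteratedDeriv_re_ofReal (hU : IsOpen U) (hF : DifferentiableOn ℂ F U) (n : ℕ) {t : ℝ}
    (ht : (t : ℂ) ∈ U) :
    iteratedDeriv n (fun s : ℝ => (F s).re) t = (iteratedDeriv n F t).re := by
  induction n generalizing t with
  | zero => simp
  | succ n ih =>
    rw [iteratedDeriv_succ]
    have hV : ∀ᶠ s in 𝓝 t, ((s : ℝ) : ℂ) ∈ U :=
      Complex.continuous_ofReal.continuousAt.preimage_mem_nhds (hU.mem_nhds ht)
    have hEq : (iteratedDeriv n fun s : ℝ => (F s).re) =ᶠ[𝓝 t] fun s : ℝ => (iteratedDeriv n F s).re :=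
      hV.mono fun s hs => ih hs
    rw [hEq.deriv_eq]
    exact (hasDerivAt_re_iteratedDeriv hU hF n ht).deriv

/-- The real trace `t ↦ Re F(t)` is `C^n` (every `n`) at every real point of `U`. [folklore] -/
private theorem contDiffAt_re_ofReal (hU : IsOpen U) (hF : DifferentiableOn ℂ F U) {n : WithTop ℕ∞} {t : ℝ}
    (ht : (t : ℂ) ∈ U) : ContDiffAt ℝ n (fun s : ℝ => (F s).re) t := by
  have hFa : ContDiffAt ℂ n F (t : ℂ) := (hF.analyticAt (hU.mem_nhds ht)).contDiffAt
  have h1 : ContDiffAt ℝ n F (t : ℂ) := hFa.restrict_scalars ℝ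
  have h2 : ContDiffAt ℝ n (fun s : ℝ => F s) t :=
    h1.comp t (Complex.ofRealCLM.contDiff.contDiffAt (x := t))
  exact (Complex.reCLM.contDiff.contDiffAt (x := F t)).comp t h2

/-- The real trace `t ↦ Re F(t)` is real-analytic at every real point of `U`. [folklore] -/
private theorem analyticAt_re_ofReal (hU : IsOpen U) (hF : DifferentiableOn ℂ F U) {t : ℝ} (ht : (t : ℂ) ∈ U) :
    AnalyticAt ℝ (fun s : ℝ => (F s).re) t := by
  have hFa : AnalyticAt ℝ F (t : ℂ) := (hF.analyticAt (hU.mem_nhds ht)).restrictScalars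
  have h2 : AnalyticAt ℝ (fun s : ℝ => F s) t := hFa.comp (Complex.ofRealCLM.analyticAt t)
  exact (Complex.reCLM.analyticAt _).comp h2

/-- **Cauchy's estimate** for the `n`-th derivative at a point whose closed `r`-disc lies in `U`, from a bound `M` on `U`:
`‖F^{(n)}(z)‖ ≤ n! · M · r⁻ⁿ`. [folklore] -/
private theorem norm_iteratedDeriv_le_of_closedBall (hF : DifferentiableOn ℂ F U) {z : ℂ} {r M : ℝ} (hr : 0 < r)
    (hsub : closedBall z r ⊆ U) (hM : ∀ w ∈ U, ‖F w‖ ≤ M) (n : ℕ) :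
    ‖iteratedDeriv n F z‖ ≤ n.factorial * M / r ^ n :=
  Complex.norm_iteratedDeriv_le_of_forall_mem_sphere_norm_le n hr (hF.diffContOnCl_ball hsub)
    fun w hw => hM w (hsub (sphere_subset_closedBall hw))

variable {a b : ℝ} {f : ℝ → ℝ}

/-- A real function agreeing on `[a, b] ⊆ U` with the real trace of `F` is `C^n` on `[a, b]` for every `n` (one-sided at the
endpoints, the currency of `Step.SFHyp.betaSmooth`). [folklore] -/
private theorem contDiffOn_Icc_of_re_ofReal (hU : IsOpen U) (hF : DifferentiableOn ℂ F U)
    (hsub : ∀ t ∈ Icc a b, (t : ℂ) ∈ U) (hf : ∀ t ∈ Icc a b, f t = (F t).re) (n : ℕ) :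
    ContDiffOn ℝ n f (Icc a b) := by
  have h : ContDiffOn ℝ n (fun s : ℝ => (F s).re) (Icc a b) :=
    fun t ht => (contDiffAt_re_ofReal hU hF (hsub t ht)).contDiffWithinAt
  exact h.congr hf

/-- … its `n`-th derivative WITHIN `[a, b]` (`a < b`) at `t ∈ [a, b]` is `Re F^{(n)}(t)`. [folklore] -/
private theorem iteratedDerivWithin_Icc_eq (hU : IsOpen U) (hF : DifferentiableOn ℂ F U) (hab : a < b)
    (hsub : ∀ t ∈ Icc a b, (t : ℂ) ∈ U) (hf : ∀ t ∈ Icc a b, f t = (F t).re) (n : ℕ) {t : ℝ}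
    (ht : t ∈ Icc a b) :
    iteratedDerivWithin n f (Icc a b) t = (iteratedDeriv n F t).re := by
  rw [iteratedDerivWithin_congr (f := f) (g := fun s : ℝ => (F s).re) hf ht,
    iteratedDerivWithin_eq_iteratedDeriv (uniqueDiffOn_Icc hab) (contDiffAt_re_ofReal hU hF (hsub t ht)) ht]
  exact iteratedDeriv_re_ofReal hU hF n (hsub t ht)

/-- … it is real-analytic within `[a, b]` (the currency of `B12BetaSmooth.BetaAnalyticAt`). [folklore] -/
private theorem analyticOn_Icc_of_re_ofReal (hU : IsOpen U) (hF : DifferentiableOn ℂ F U)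
    (hsub : ∀ t ∈ Icc a b, (t : ℂ) ∈ U) (hf : ∀ t ∈ Icc a b, f t = (F t).re) :
    AnalyticOn ℝ f (Icc a b) :=
  have h : AnalyticOn ℝ (fun s : ℝ => (F s).re) (Icc a b) :=
    fun t ht => (analyticAt_re_ofReal hU hF (hsub t ht)).analyticWithinAt
  h.congr hf

/-- … and **all its derivatives are bounded by Cauchy's estimate**: if the closed `r`-discs about the points of `[a, b]` lie
in `U` and `‖F‖ ≤ M` on `U`, then `|∂ⁿ f(t)| ≤ n! · M · r⁻ⁿ` on `[a, b]` (derivatives within `[a, b]`). [folklore] -/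
private theorem abs_iteratedDerivWithin_Icc_le (hU : IsOpen U) (hF : DifferentiableOn ℂ F U) (hab : a < b)
    (hf : ∀ t ∈ Icc a b, f t = (F t).re) {r M : ℝ} (hr : 0 < r)
    (hball : ∀ t ∈ Icc a b, closedBall (t : ℂ) r ⊆ U) (hM : ∀ w ∈ U, ‖F w‖ ≤ M) (n : ℕ) {t : ℝ}
    (ht : t ∈ Icc a b) :
    |iteratedDerivWithin n f (Icc a b) t| ≤ n.factorial * M / r ^ n := by
  have hsub : ∀ s ∈ Icc a b, (s : ℂ) ∈ U := fun s hs => hball s hs (mem_closedBall_self hr.le)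
  rw [iteratedDerivWithin_Icc_eq hU hF hab hsub hf n ht]
  exact (Complex.abs_re_le_norm _).trans (norm_iteratedDeriv_le_of_closedBall hF hr (hball t ht) hM n)

/-- **The uniform margin is free**: for an open `U ⊆ ℂ` containing the compact segment `[a, b]` there is `r > 0` with every
closed `r`-disc about a point of `[a, b]` inside `U`. [folklore] -/
private theorem exists_margin (hU : IsOpen U) (hsub : ∀ t ∈ Icc a b, (t : ℂ) ∈ U) :
    ∃ r > 0, ∀ t ∈ Icc a b, closedBall (t : ℂ) r ⊆ U := by
  have hK : IsCompact (((↑) : ℝ → ℂ) '' Icc a b) := isCompact_Icc.image Complex.continuous_ofReal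
  have hKU : ((↑) : ℝ → ℂ) '' Icc a b ⊆ U := by
    rintro _ ⟨t, ht, rfl⟩; exact hsub t ht
  obtain ⟨δ, hδ, hthick⟩ := hK.exists_cthickening_subset_open hU hKU
  refine ⟨δ, hδ, fun t ht z hz => hthick ?_⟩
  have hmem : ((t : ℝ) : ℂ) ∈ ((↑) : ℝ → ℂ) '' Icc a b := ⟨t, ht, rfl⟩
  exact (closedBall_subset_cthickening_singleton (t : ℂ) δ |>.trans
    (cthickening_subset_of_subset δ (singleton_subset_iff.2 hmem))) hz

end RealTrace

/-! ## Part 1b. Dominated lattice sums of kernels holomorphic in the coupling -/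

section Moment

variable {d : ℕ} {U : Set ℂ}

/-- Pointwise: `‖P(x) x_μ x_ν‖ ≤ C |x|₁² e^{−δ₁|x|₁}` from `‖P(x)‖ ≤ C e^{−δ₁|x|₁}` (complex values; the real case is
`B12Sec2to5.abs_term_le_of_decay510`, applied here to the real kernel `x ↦ ‖P(x)‖`). [folklore] -/
private theorem norm_term_le {P : (Fin d → ℤ) → ℂ} {C δ₁ : ℝ} (h : ∀ x, ‖P x‖ ≤ C * Real.exp (-δ₁ * B12Sec2to5.l1 x))
    (μ ν : Fin d) (x : Fin d → ℤ) :
    ‖P x * (x μ : ℂ) * (x ν : ℂ)‖ ≤ C * (B12Sec2to5.l1 x ^ 2 * Real.exp (-δ₁ * B12Sec2to5.l1 x)) := by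
  have hdec : B12Sec2to5.Decay510 (fun y : Fin d → ℤ => ‖P y‖) C δ₁ := fun y => by rw [abs_norm]; exact h y
  have h1 := B12Sec2to5.abs_term_le_of_decay510 hdec μ ν x
  have h2 : ‖P x * (x μ : ℂ) * (x ν : ℂ)‖ = |‖P x‖ * (x μ : ℝ) * (x ν : ℝ)| := by
    rw [norm_mul, norm_mul, abs_mul, abs_mul, abs_norm, Complex.norm_intCast, Complex.norm_intCast]
  rw [h2]; exact h1

/-- **A dominated lattice sum of holomorphic kernels is holomorphic**: if every `g ↦ P(g, x)` is holomorphic on the open `U`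
and `‖P(g, x)‖ ≤ C e^{−δ₁|x|₁}` there (`δ₁ > 0`), then `g ↦ Σ_x P(g, x) x_μ x_ν` is holomorphic on `U` (locally uniform
convergence; Mathlib `Complex.differentiableOn_tsum_of_summable_norm`). [folklore] -/
private theorem differentiableOn_momentC (hU : IsOpen U) (P : ℂ → (Fin d → ℤ) → ℂ) (μ ν : Fin d) {C δ₁ : ℝ}
    (hδ₁ : 0 < δ₁) (holo : ∀ x, DifferentiableOn ℂ (fun g => P g x) U)
    (decay : ∀ x, ∀ g ∈ U, ‖P g x‖ ≤ C * Real.exp (-δ₁ * B12Sec2to5.l1 x)) :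
    DifferentiableOn ℂ (fun g => ∑' x : Fin d → ℤ, P g x * (x μ : ℂ) * (x ν : ℂ)) U :=
  Complex.differentiableOn_tsum_of_summable_norm (u := fun x => C * (B12Sec2to5.l1 x ^ 2 * Real.exp (-δ₁ * B12Sec2to5.l1 x)))
    ((B12Sec2to5.majorant_summable hδ₁ d).mul_left C) (fun x => ((holo x).mul_const _).mul_const _) hU
    fun x g hg => norm_term_le (fun y => decay y g hg) μ ν x

/-- … and it is bounded on `U` by `B12Sec2to5.betaPrime510 d C δ₁ = C · Σ_x |x|₁² e^{−δ₁|x|₁}` (dominated summation). [folklore] -/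
private theorem norm_momentC_le (P : ℂ → (Fin d → ℤ) → ℂ) (μ ν : Fin d) {C δ₁ : ℝ} (hδ₁ : 0 < δ₁)
    (decay : ∀ x, ∀ g ∈ U, ‖P g x‖ ≤ C * Real.exp (-δ₁ * B12Sec2to5.l1 x)) {g : ℂ} (hg : g ∈ U) :
    ‖∑' x : Fin d → ℤ, P g x * (x μ : ℂ) * (x ν : ℂ)‖ ≤ B12Sec2to5.betaPrime510 d C δ₁ := by
  have hS := ((B12Sec2to5.majorant_summable hδ₁ d).mul_left C).hasSum
  have h := tsum_of_norm_bounded hS fun x => norm_term_le (fun y => decay y g hg) μ ν x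
  unfold B12Sec2to5.betaPrime510
  rwa [← tsum_mul_left]

/-- The terms are summable at every point of `U`. [folklore] -/
private theorem summable_momentC (P : ℂ → (Fin d → ℤ) → ℂ) (μ ν : Fin d) {C δ₁ : ℝ} (hδ₁ : 0 < δ₁)
    (decay : ∀ x, ∀ g ∈ U, ‖P g x‖ ≤ C * Real.exp (-δ₁ * B12Sec2to5.l1 x)) {g : ℂ} (hg : g ∈ U) :
    Summable (fun x : Fin d → ℤ => P g x * (x μ : ℂ) * (x ν : ℂ)) :=
  Summable.of_norm_bounded ((B12Sec2to5.majorant_summable hδ₁ d).mul_left C)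
    fun x => norm_term_le (fun y => decay y g hg) μ ν x

/-- At a point where the kernel is real (`P(g, x) = Re P(g, x)` read through a real kernel `Q`), the real second moment
`B12Beta.secondMoment` ((1.22)∕(5.42)) is the real part of the complex lattice sum. [cite: Balaban1987RG1, (1.22) p.264] -/
private theorem secondMoment_eq_re (P : ℂ → (Fin d → ℤ) → ℂ) (Q : B12Beta.Kernel d) (μ ν : Fin d) {C δ₁ : ℝ}
    (hδ₁ : 0 < δ₁) (decay : ∀ x, ∀ g ∈ U, ‖P g x‖ ≤ C * Real.exp (-δ₁ * B12Sec2to5.l1 x)) {g : ℂ} (hg : g ∈ U)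
    (hQ : ∀ x, Q μ ν x = (P g x).re) :
    B12Beta.secondMoment Q μ ν = (∑' x : Fin d → ℤ, P g x * (x μ : ℂ) * (x ν : ℂ)).re := by
  rw [B12Beta.secondMoment, ← (Complex.hasSum_re (summable_momentC P μ ν hδ₁ decay hg).hasSum).tsum_eq]
  refine tsum_congr fun x => ?_
  rw [hQ x]
  simp [Complex.mul_re]

end Moment

/-! ## Part 2. The tower-level source: a holomorphic polarization kernel ⇒ every β-clause of the step -/

section Tower

variable {P : Params} {G : Type*} [GaugeGroup G] {Φ 𝒢 : Type*}

/-- **LOCATED INPUT in the «(or analytic)» alternative of p. 266: the §5 source with a HOLOMORPHIC kernel.**  The data of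
`B12StepObligation.Beta542Source` — (5.42)∕(1.22): `β_{k+1}(g)` is the second moment of a real kernel family `Pk g` at a pair
`(μ, ν)`; `B12Sec2to5.betaPrime510 d C δ₁ ≤ β′` — whose `(μ, ν)`-component is, for `g ∈ [0, γ]`, the REAL PART of a kernel `Pc(g, x)` that is
HOLOMORPHIC in the coupling `g` on an open `U ⊆ ℂ` containing the closed `r`-discs about `[0, γ]` (`r > 0`; free by `exists_margin`)
and obeys (5.10) p. 293 ON `U`: `‖Pc(g, x)‖ ≤ C e^{−δ₁|x|₁}`, `δ₁ > 0`.  In print `Π_{k+1,μν}(g_k, x)` is (1.20)–(1.21) p. 264 at real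
couplings; its holomorphic extension in `g_k` is what p. 266's *«E^{(j)}, β_j are analytic functions of the effective coupling
constants»* provides through (1.20) (companion module `B12PolarizationHolo`).  Data + hypotheses, never asserted.
[cite: Balaban1987RG1, (1.20)–(1.22) p.264, p.266 (analytic alternative), (5.10) p.293, (5.42) p.297] -/
structure PiHoloSource (T : SFTower P G Φ 𝒢) (c : SFConsts) (k : ℕ) where
  /-- dimension of the unit lattice `ℤ^d` of (1.21) -/
  d : ℕ
  /-- the pair `μ ≠ ν` of (1.22) (left to the instantiating reader, as in `Beta542Source`) -/
  μ : Fin d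
  ν : Fin d
  /-- the real kernel family `Π^{(k+1)}(g, ·)` of (1.21), one kernel per real value of the coupling -/
  Pk : ℝ → B12Beta.Kernel d
  /-- (5.42)∕(1.22): `β_{k+1}(g) = Σ_x Π^{(k+1)}_{μν}(g, x) x_μ x_ν` for `g ∈ [0, γ]` -/
  beta_eq : ∀ g, 0 ≤ g → g ≤ c.γ → T.flow.β (k + 1) g = B12Beta.secondMoment (Pk g) μ ν
  /-- the complex neighbourhood of `[0, γ]` in the coupling plane -/
  U : Set ℂ
  isOpen : IsOpen U
  /-- uniform margin: the closed `r`-discs about `[0, γ]` lie in `U` -/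
  r : ℝ
  r_pos : 0 < r
  ball_subset : ∀ t ∈ Set.Icc (0 : ℝ) c.γ, closedBall (t : ℂ) r ⊆ U
  /-- the holomorphic extension of `g ↦ Π^{(k+1)}_{μν}(g, x)` -/
  Pc : ℂ → (Fin d → ℤ) → ℂ
  holo : ∀ x, DifferentiableOn ℂ (fun g => Pc g x) U
  /-- (5.10) on `U` -/
  C : ℝ
  δ₁ : ℝ
  δ₁_pos : 0 < δ₁
  decay : ∀ x, ∀ g ∈ U, ‖Pc g x‖ ≤ C * Real.exp (-δ₁ * B12Sec2to5.l1 x)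
  /-- on `[0, γ]` the real kernel's `(μ, ν)`-component is the real part of `Pc` -/
  re_eq : ∀ x, ∀ t ∈ Set.Icc (0 : ℝ) c.γ, Pk t μ ν x = (Pc t x).re
  /-- the cell's uniform bound `β′` dominates the explicit §5 constant -/
  le_beta' : B12Sec2to5.betaPrime510 d C δ₁ ≤ c.β'

namespace PiHoloSource

variable {T : SFTower P G Φ 𝒢} {c : SFConsts} {k : ℕ}

/-- `[0, γ] ⊆ U`. [folklore] -/
private theorem mem_U (S : PiHoloSource T c k) {t : ℝ} (ht : t ∈ Set.Icc (0 : ℝ) c.γ) : (t : ℂ) ∈ S.U :=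
  S.ball_subset t ht (mem_closedBall_self S.r_pos.le)

/-- (5.10) for the real kernel on `[0, γ]`: `|Π^{(k+1)}_{μν}(g, x)| ≤ C e^{−δ₁|x|₁}` (`|Re z| ≤ ‖z‖`). [cite: Balaban1987RG1, (5.10) p.293] -/
theorem decay_real (S : PiHoloSource T c k) {t : ℝ} (ht : t ∈ Set.Icc (0 : ℝ) c.γ) :
    B12Sec2to5.Decay510 (S.Pk t S.μ S.ν) S.C S.δ₁ := fun x => by
  rw [S.re_eq x t ht]
  exact (Complex.abs_re_le_norm _).trans (S.decay x t (S.mem_U ht))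

/-- The holomorphic source FORGETS to the §5 source of the plain bound (`B12StepObligation.Beta542Source`). [cite: Balaban1987RG1, (5.42) p.297 with (5.10) p.293] -/
def toBeta542Source (S : PiHoloSource T c k) : Beta542Source T c k where
  d := S.d
  μ := S.μ
  ν := S.ν
  Pk := S.Pk
  C := S.C
  δ₁ := S.δ₁
  δ₁_pos := S.δ₁_pos
  beta_eq := S.beta_eq
  decay := fun _ hg0 hgγ => S.decay_real ⟨hg0, hgγ⟩
  le_beta' := S.le_beta'

/-- `betaBound` at the new index: `|β_{k+1}(g)| ≤ β′` on `[0, γ]`. [cite: Balaban1987RG1, p.264 («uniformly bounded on this interval»)] -/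
theorem betaBound (S : PiHoloSource T c k) : ∀ x ∈ Set.Icc (0 : ℝ) c.γ, |T.flow.β (k + 1) x| ≤ c.β' :=
  betaBound_of_beta542 S.toBeta542Source

/-- **THE Π-INPUT OF `B12BetaSmooth` DISCHARGED, with explicit constants**: a holomorphic source yields
`B12BetaSmooth.PiSmoothSource T c k` — smoothness of `g ↦ Π^{(k+1)}_{μν}(g, x)` on `[0, γ]` (real trace of a holomorphic function)
and the decay of EVERY g-derivative `|∂ⁿ_g Π^{(k+1)}_{μν}(g, x)| ≤ Cₙ e^{−δ₁|x|₁}` with `Cₙ = n! · C · r⁻ⁿ` (Cauchy's estimate on the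
`r`-discs, where (5.10) holds).  `γ > 0` makes `[0, γ]` a set of unique differentiability. [cite: Balaban1987RG1, p.264 (β-clause) with p.266 and (5.10) p.293] -/
def toPiSmoothSource (hγ : 0 < c.γ) (S : PiHoloSource T c k) : PiSmoothSource T c k where
  toBeta542Source := S.toBeta542Source
  Cn := fun n => n.factorial * S.C / S.r ^ n
  smooth := fun x n =>
    contDiffOn_Icc_of_re_ofReal (f := fun g => S.Pk g S.μ S.ν x) S.isOpen (S.holo x)
      (fun t ht => S.mem_U ht) (fun t ht => S.re_eq x t ht) n
  decayDeriv := fun n x g hg => by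
    have h := abs_iteratedDerivWithin_Icc_le (f := fun g' => S.Pk g' S.μ S.ν x) S.isOpen (S.holo x) hγ
      (fun t ht => S.re_eq x t ht) S.r_pos S.ball_subset (fun w hw => S.decay x w hw) n hg
    calc |iteratedDerivWithin n (fun g' => S.Pk g' S.μ S.ν x) (Set.Icc 0 c.γ) g|
        ≤ n.factorial * (S.C * Real.exp (-S.δ₁ * B12Sec2to5.l1 x)) / S.r ^ n := h
      _ = n.factorial * S.C / S.r ^ n * Real.exp (-S.δ₁ * B12Sec2to5.l1 x) := by ring

/-- **THE UNSOURCED CLAUSE, DERIVED in the analytic alternative**: `B12StepObligation.BetaSmoothAt T c k` — `β_{k+1}` is `C^n` on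
`[0, γ]` for every `n` (p. 264 *«It is a smooth function defined on the interval [0, γ]»*). [cite: Balaban1987RG1, p.264 (β-clause after (1.22))] -/
theorem betaSmoothAt (hγ : 0 < c.γ) (S : PiHoloSource T c k) : BetaSmoothAt T c k :=
  betaSmoothAt_of_piSmooth hγ (S.toPiSmoothSource hγ)

/-- The complexified β-function `β^ℂ_{k+1}(g) = Σ_x Pc(g, x) x_μ x_ν` on `U` ((1.22) read at complex couplings). [cite: Balaban1987RG1, (1.22) p.264] -/
def betaC (S : PiHoloSource T c k) (g : ℂ) : ℂ := ∑' x : Fin S.d → ℤ, S.Pc g x * (x S.μ : ℂ) * (x S.ν : ℂ)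

/-- `β^ℂ_{k+1}` ((1.22) at complex couplings) is holomorphic on `U` — p. 266 *«β_j are analytic functions of the effective coupling constants»* for the new index, derived from the holomorphic kernel. [cite: Balaban1987RG1, p.266 (analytic alternative) with (1.22) p.264] -/
theorem differentiableOn_betaC (S : PiHoloSource T c k) : DifferentiableOn ℂ S.betaC S.U :=
  differentiableOn_momentC S.isOpen S.Pc S.μ S.ν S.δ₁_pos S.holo S.decay

/-- `‖β^ℂ_{k+1}‖ ≤ betaPrime510 d C δ₁` on `U`: the (5.10) ⇒ |β| ≤ β′ summation ((5.42) p. 297 with (5.10) p. 293; real case `B12Sec2to5.secondMoment_abs_le_of_decay510`) at complex couplings. [cite: Balaban1987RG1, (5.42) p.297 with (5.10) p.293] -/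
theorem norm_betaC_le (S : PiHoloSource T c k) {g : ℂ} (hg : g ∈ S.U) : ‖S.betaC g‖ ≤ B12Sec2to5.betaPrime510 S.d S.C S.δ₁ :=
  norm_momentC_le S.Pc S.μ S.ν S.δ₁_pos S.decay hg

/-- On `[0, γ]`, `β_{k+1}` IS the real trace of `β^ℂ_{k+1}` ((5.42) + `re_eq`). [cite: Balaban1987RG1, (5.42) p.297] -/
theorem beta_eq_re_betaC (S : PiHoloSource T c k) {t : ℝ} (ht : t ∈ Set.Icc (0 : ℝ) c.γ) :
    T.flow.β (k + 1) t = (S.betaC t).re := by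
  rw [S.beta_eq t ht.1 ht.2]
  exact secondMoment_eq_re S.Pc (S.Pk t) S.μ S.ν S.δ₁_pos S.decay (S.mem_U ht) fun x => S.re_eq x t ht

/-- **«(or analytic)» DERIVED**: `B12BetaSmooth.BetaAnalyticAt T c k` — `β_{k+1}` is real-analytic within `[0, γ]`, being the real
trace of the holomorphic `β^ℂ_{k+1}`. [cite: Balaban1987RG1, p.264 («(or analytic)») with p.266] -/
theorem betaAnalyticAt (S : PiHoloSource T c k) : BetaAnalyticAt T c k :=
  analyticOn_Icc_of_re_ofReal S.isOpen S.differentiableOn_betaC (fun _ ht => S.mem_U ht)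
    fun _ ht => S.beta_eq_re_betaC ht

/-- **«uniformly bounded on this interval together with all derivatives» DERIVED, with explicit constants**:
`|∂ⁿ_g β_{k+1}(g)| ≤ n! · r⁻ⁿ · B12Sec2to5.betaPrime510 d C δ₁` on `[0, γ]` for every `n` (`B12BetaSmooth.BetaDerivBoundsAt`; Cauchy's estimate
for `β^ℂ_{k+1}` on the `r`-discs) — uniform in the step `k` exactly in so far as `C, δ₁, r, d` are. [cite: Balaban1987RG1, p.264 (β-clause after (1.22))] -/
theorem betaDerivBounds (hγ : 0 < c.γ) (S : PiHoloSource T c k) :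
    BetaDerivBoundsAt T c k (fun n => n.factorial * B12Sec2to5.betaPrime510 S.d S.C S.δ₁ / S.r ^ n) :=
  fun n _ hg => abs_iteratedDerivWithin_Icc_le S.isOpen S.differentiableOn_betaC hγ
    (fun _ ht => S.beta_eq_re_betaC ht) S.r_pos S.ball_subset (fun _ hw => S.norm_betaC_le hw) n hg

/-- The (AF-1)-shaped consequence (shape of `B12Beta.betaLower_of_split`'s remainder hypothesis): `|β_{k+1}(g) − β_{k+1}(0)| ≤
(B12Sec2to5.betaPrime510 d C δ₁ ∕ r) · g` on `[0, γ]` (mean value theorem + the first Cauchy bound).  Nothing about the SIGN of `β_{k+1}(0)`.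
[cite: Balaban1987RG1, p.264 (β-clause after (1.22))] -/
theorem betaLipschitzAtZero (hγ : 0 < c.γ) (S : PiHoloSource T c k) :
    ∀ g ∈ Set.Icc (0 : ℝ) c.γ,
      |T.flow.β (k + 1) g - T.flow.β (k + 1) 0| ≤ B12Sec2to5.betaPrime510 S.d S.C S.δ₁ / S.r * g := by
  have h1 : ContDiffOn ℝ 1 (T.flow.β (k + 1)) (Set.Icc 0 c.γ) := by exact_mod_cast S.betaSmoothAt hγ 1
  have h2 := S.betaDerivBounds hγ 1
  refine lipschitzAtZero_of_derivBound hγ h1 fun x hx => (h2 x hx).trans_eq ?_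
  simp

/-- **THE PER-STEP DELIVERABLE WITH BOTH β-CLAUSES FROM ONE HOLOMORPHIC SOURCE**: `Step.SFNewTerm T c k` assembled by
`B12StepObligation.sfNewTerm_of_bound` with `Beta542Source` := the projection and `BetaSmoothAt` := `betaSmoothAt` — no separate
unsourced smoothness hypothesis.  Bookkeeping; the β-side open input is now «Π^{(k+1)} holomorphic in g with (5.10) on a complex
neighbourhood of [0, γ]». [cite: Balaban1988RG2Cluster, p.22 («completes the proof of the inductive assumptions for the action A_{k+1}»)] -/
theorem sfNewTerm_of_bound_piHolo {S₂ : ℝ → B13.StepData} (Δ : StepDict T c k S₂) {E₀' κ' : ℝ}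
    (hE₀ : E₀' ≤ c.E₀) (hE₀' : 0 ≤ E₀') (hκ : c.κ ≤ κ') (hκ0 : 0 ≤ c.κ)
    (hbound : ∀ g, 0 ≤ g → g ≤ c.γ → B13.Bound118 (S₂ g).Dk1 (S₂ g).sp2 (Δ.F g) E₀' κ')
    (hrepr : ∀ g, (S₂ g).Repr17) (hgauge : ∀ g X, (S₂ g).GaugeInv (Δ.F g X))
    (hrg : 1 / (T.flow.g k) ^ 2 = 1 / (T.flow.g (k + 1)) ^ 2 + T.flow.β (k + 1) (T.flow.g k))
    (hsp : SpacesGaugeInvariant T c (k + 1)) (hγ : 0 < c.γ) (S : PiHoloSource T c k) :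
    SFNewTerm T c k :=
  sfNewTerm_of_bound Δ hE₀ hE₀' hκ hκ0 hbound hrepr hgauge hrg hsp S.toBeta542Source (S.betaSmoothAt hγ)

/-- Reading (I.1.6) corollary (`B12StepObligation.sfNewTerm_of_deliverables` with the β-side from the holomorphic source): [II]'s
delivered clauses at every `g ∈ [0, γ]` + dictionary + constants + (2.15) + p. 263 + ONE `PiHoloSource` ⇒ `SFNewTerm T c k`.
[cite: Balaban1988RG2Cluster, p.21–22] -/
theorem sfNewTerm_of_deliverables_piHolo {S₂ : ℝ → B13.StepData} {c13 : B13.Consts} (Δ : StepDict T c k S₂)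
    (hF : ∀ g, Δ.F g = (S₂ g).Etot) (hc : ConstsCompare c13 c)
    (hdel : ∀ g, 0 ≤ g → g ≤ c.γ → B13.Deliverables (S₂ g) c13)
    (hrepr : ∀ g, (S₂ g).Repr17) (hgauge : ∀ g X, (S₂ g).GaugeInv ((S₂ g).Etot X))
    (hrg : 1 / (T.flow.g k) ^ 2 = 1 / (T.flow.g (k + 1)) ^ 2 + T.flow.β (k + 1) (T.flow.g k))
    (hsp : SpacesGaugeInvariant T c (k + 1)) (hγ : 0 < c.γ) (S : PiHoloSource T c k) :
    SFNewTerm T c k :=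
  sfNewTerm_of_deliverables Δ hF hc hdel hrepr hgauge hrg hsp S.toBeta542Source (S.betaSmoothAt hγ)

end PiHoloSource

/-- **Building a source without a margin in hand**: the data of `PiHoloSource` with `U ⊇ [0, γ]` open (no `r`) determine one
(the margin exists by compactness, `exists_margin`).  Bookkeeping form of the located input. [cite: Balaban1987RG1, (1.20)–(1.22) p.264 with p.266 (analytic alternative) and (5.10) p.293] -/
theorem nonempty_piHoloSource {T : SFTower P G Φ 𝒢} {c : SFConsts} {k : ℕ} {d : ℕ} (μ ν : Fin d)
    (Pk : ℝ → B12Beta.Kernel d)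
    (beta_eq : ∀ g, 0 ≤ g → g ≤ c.γ → T.flow.β (k + 1) g = B12Beta.secondMoment (Pk g) μ ν)
    {U : Set ℂ} (hU : IsOpen U) (hIU : ∀ t ∈ Set.Icc (0 : ℝ) c.γ, (t : ℂ) ∈ U)
    (Pc : ℂ → (Fin d → ℤ) → ℂ) (holo : ∀ x, DifferentiableOn ℂ (fun g => Pc g x) U) {C δ₁ : ℝ} (hδ₁ : 0 < δ₁)
    (decay : ∀ x, ∀ g ∈ U, ‖Pc g x‖ ≤ C * Real.exp (-δ₁ * B12Sec2to5.l1 x))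
    (re_eq : ∀ x, ∀ t ∈ Set.Icc (0 : ℝ) c.γ, Pk t μ ν x = (Pc t x).re) (le_beta' : B12Sec2to5.betaPrime510 d C δ₁ ≤ c.β') :
    Nonempty (PiHoloSource T c k) := by
  obtain ⟨r, hr, hball⟩ := exists_margin hU hIU
  exact ⟨{ d := d, μ := μ, ν := ν, Pk := Pk, beta_eq := beta_eq, U := U, isOpen := hU, r := r, r_pos := hr,
           ball_subset := hball, Pc := Pc, holo := holo, C := C, δ₁ := δ₁, δ₁_pos := hδ₁, decay := decay,
           re_eq := re_eq, le_beta' := le_beta' }⟩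

/-- **END TO END at the step (kernel-checked composition).**  A holomorphic Π-source and `γ > 0` give ALL β-clauses of the
Theorem-3 step at the new index: smoothness (`BetaSmoothAt`, the unsourced clause of GAPS C-B12s-E1), analyticity (`BetaAnalyticAt`,
the «(or analytic)» reading), the plain bound `|β_{k+1}| ≤ β′`, and bounds on all derivatives with the explicit constants
`n! · r⁻ⁿ · B12Sec2to5.betaPrime510 d C δ₁`.  Compare `B12BetaSmooth.betaClauses_of_transfer`, whose inputs `PolarizationDerivTransfer` ∕
`EDerivBound118` were untyped ∕ unprinted: here the input is ONE located analytic-currency statement about Π. [cite: Balaban1987RG1, p.264 (β-clause) with p.266 (analytic alternative)] -/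
theorem betaClauses_of_piHolo {T : SFTower P G Φ 𝒢} {c : SFConsts} {k : ℕ} (hγ : 0 < c.γ) (S : PiHoloSource T c k) :
    BetaSmoothAt T c k ∧ BetaAnalyticAt T c k ∧ (∀ x ∈ Set.Icc (0 : ℝ) c.γ, |T.flow.β (k + 1) x| ≤ c.β') ∧
      BetaDerivBoundsAt T c k (fun n => n.factorial * B12Sec2to5.betaPrime510 S.d S.C S.δ₁ / S.r ^ n) :=
  ⟨S.betaSmoothAt hγ, S.betaAnalyticAt, S.betaBound, S.betaDerivBounds hγ⟩

end Tower

/-! ## Part 3 (v2, append-only). The p. 263 clause on the TERMS at the new index, from holomorphy in the coupling -/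

section ComplexTrace

variable {U : Set ℂ} {F : ℂ → ℂ}

/-- On the (open) real trace of `U`, the `n`-th real derivative of the ℂ-valued trace `t ↦ F(t)` is `F^{(n)}(t)`. [folklore] -/
private theorem iteratedDeriv_comp_ofReal (hU : IsOpen U) (hF : DifferentiableOn ℂ F U) (n : ℕ) {t : ℝ}
    (ht : (t : ℂ) ∈ U) :
    iteratedDeriv n (fun s : ℝ => F s) t = iteratedDeriv n F t := by
  induction n generalizing t with
  | zero => simp
  | succ n ih =>
    rw [iteratedDeriv_succ, iteratedDeriv_succ]
    have hV : ∀ᶠ s in 𝓝 t, ((s : ℝ) : ℂ) ∈ U :=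
      Complex.continuous_ofReal.continuousAt.preimage_mem_nhds (hU.mem_nhds ht)
    have hEq : (iteratedDeriv n fun s : ℝ => F s) =ᶠ[𝓝 t] fun s : ℝ => iteratedDeriv n F s :=
      hV.mono fun s hs => ih hs
    rw [hEq.deriv_eq]
    have h1 : HasDerivAt (iteratedDeriv n F) (deriv (iteratedDeriv n F) t) t :=
      ((differentiableOn_iteratedDeriv hU hF n).differentiableAt (hU.mem_nhds ht)).hasDerivAt
    exact h1.comp_ofReal.deriv

/-- The ℂ-valued trace `t ↦ F(t)` is `C^n` (every `n`) at every real point of `U`. [folklore] -/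
private theorem contDiffAt_comp_ofReal (hU : IsOpen U) (hF : DifferentiableOn ℂ F U) {n : WithTop ℕ∞} {t : ℝ}
    (ht : (t : ℂ) ∈ U) : ContDiffAt ℝ n (fun s : ℝ => F s) t := by
  have hFa : ContDiffAt ℂ n F (t : ℂ) := (hF.analyticAt (hU.mem_nhds ht)).contDiffAt
  exact (hFa.restrict_scalars ℝ).comp t (Complex.ofRealCLM.contDiff.contDiffAt (x := t))

/-- The ℂ-valued trace is real-analytic at every real point of `U`. [folklore] -/
private theorem analyticAt_comp_ofReal (hU : IsOpen U) (hF : DifferentiableOn ℂ F U) {t : ℝ}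
    (ht : (t : ℂ) ∈ U) : AnalyticAt ℝ (fun s : ℝ => F s) t :=
  ((hF.analyticAt (hU.mem_nhds ht)).restrictScalars (𝕜 := ℝ)).comp (Complex.ofRealCLM.analyticAt t)

variable {a b : ℝ} {f : ℝ → ℂ}

/-- A ℂ-valued function of a real variable agreeing on `[a, b] ⊆ U` with the trace of `F` is `C^n` on `[a, b]`. [folklore] -/
private theorem contDiffOn_Icc_of_comp_ofReal (hU : IsOpen U) (hF : DifferentiableOn ℂ F U)
    (hsub : ∀ t ∈ Icc a b, (t : ℂ) ∈ U) (hf : ∀ t ∈ Icc a b, f t = F t) (n : ℕ) :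
    ContDiffOn ℝ n f (Icc a b) := by
  have h : ContDiffOn ℝ n (fun s : ℝ => F s) (Icc a b) :=
    fun t ht => (contDiffAt_comp_ofReal hU hF (hsub t ht)).contDiffWithinAt
  exact h.congr hf

/-- … it is real-analytic within `[a, b]`. [folklore] -/
private theorem analyticOn_Icc_of_comp_ofReal (hU : IsOpen U) (hF : DifferentiableOn ℂ F U)
    (hsub : ∀ t ∈ Icc a b, (t : ℂ) ∈ U) (hf : ∀ t ∈ Icc a b, f t = F t) :
    AnalyticOn ℝ f (Icc a b) :=
  have h : AnalyticOn ℝ (fun s : ℝ => F s) (Icc a b) :=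
    fun t ht => (analyticAt_comp_ofReal hU hF (hsub t ht)).analyticWithinAt
  h.congr hf

/-- … and its derivatives within `[a, b]` obey Cauchy's estimate `‖∂ⁿ f(t)‖ ≤ n! · M · r⁻ⁿ` when the closed `r`-discs about
`[a, b]` lie in `U` and `‖F‖ ≤ M` on `U`. [folklore] -/
private theorem norm_iteratedDerivWithin_Icc_le (hU : IsOpen U) (hF : DifferentiableOn ℂ F U) (hab : a < b)
    (hf : ∀ t ∈ Icc a b, f t = F t) {r M : ℝ} (hr : 0 < r)
    (hball : ∀ t ∈ Icc a b, closedBall (t : ℂ) r ⊆ U) (hM : ∀ w ∈ U, ‖F w‖ ≤ M) (n : ℕ) {t : ℝ}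
    (ht : t ∈ Icc a b) :
    ‖iteratedDerivWithin n f (Icc a b) t‖ ≤ n.factorial * M / r ^ n := by
  have hsub : ∀ s ∈ Icc a b, (s : ℂ) ∈ U := fun s hs => hball s hs (mem_closedBall_self hr.le)
  rw [iteratedDerivWithin_congr (f := f) (g := fun s : ℝ => F s) hf ht,
    iteratedDerivWithin_eq_iteratedDeriv (uniqueDiffOn_Icc hab) (contDiffAt_comp_ofReal hU hF (hsub t ht)) ht,
    iteratedDeriv_comp_ofReal hU hF n (hsub t ht)]
  exact norm_iteratedDeriv_le_of_closedBall hF hr (hball t ht) hM n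

end ComplexTrace

section Terms

variable {P : Params} {G : Type*} [GaugeGroup G] {Φ 𝒢 : Type*}

/-- **LOCATED INPUT in the «(or analytic)» alternative of p. 266: the NEW TERM holomorphic in the coupling.**  For every domain
`X` and configuration `φ` in the analyticity domain `Uᶜ_{k+1}(X, α₀, α₁)`, the new term `g ↦ E^{(k+1)}(X, g, φ)` is, on `[0, γ]`, the
trace of a function `Ec X φ` HOLOMORPHIC on an open `U ⊆ ℂ` containing the closed `r`-discs about `[0, γ]`, with (1.18) ON `U`:
`‖Ec X φ g‖ ≤ E₀ e^{−κ d_{k+1}(X)}` (p. 263 (1.18); p. 266 *«the functions E^{(j)} … are analytic functions of the effective coupling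
constants»*).  Data + hypotheses, never asserted. [cite: Balaban1987RG1, p.263 (clause before (1.18)) with p.266 (analytic alternative)] -/
structure EHoloAt (T : SFTower P G Φ 𝒢) (c : SFConsts) (k : ℕ) where
  /-- the complex neighbourhood of `[0, γ]` in the coupling plane -/
  U : Set ℂ
  isOpen : IsOpen U
  /-- uniform margin -/
  r : ℝ
  r_pos : 0 < r
  ball_subset : ∀ t ∈ Set.Icc (0 : ℝ) c.γ, closedBall (t : ℂ) r ⊆ U
  /-- the holomorphic extension in `g` of the new term at `(X, φ)` -/
  Ec : (T.sys (k + 1)).Dom → Φ → ℂ → ℂ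
  holo : ∀ X φ, φ ∈ T.space (k + 1) X c.α₀ c.α₁ → DifferentiableOn ℂ (Ec X φ) U
  /-- the tower's new term is the trace on `[0, γ]` -/
  eq : ∀ X φ, φ ∈ T.space (k + 1) X c.α₀ c.α₁ → ∀ t ∈ Set.Icc (0 : ℝ) c.γ, T.E (k + 1) X t φ = Ec X φ t
  /-- (1.18) on `U` -/
  E₀ : ℝ
  bound : ∀ X φ, φ ∈ T.space (k + 1) X c.α₀ c.α₁ → ∀ g ∈ U, ‖Ec X φ g‖ ≤ E₀ * Real.exp (-c.κ * (T.sys (k + 1)).dj X)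

namespace EHoloAt

variable {T : SFTower P G Φ 𝒢} {c : SFConsts} {k : ℕ}

/-- `[0, γ] ⊆ U`. [folklore] -/
private theorem mem_U (S : EHoloAt T c k) {t : ℝ} (ht : t ∈ Set.Icc (0 : ℝ) c.γ) : (t : ℂ) ∈ S.U :=
  S.ball_subset t ht (mem_closedBall_self S.r_pos.le)

/-- **p. 263 «(or analytic)» at the new index, DERIVED**: `B12BetaSmooth.EAnalyticAt T c k`. [cite: Balaban1987RG1, p.263 (clause before (1.18)) with p.266] -/
theorem eAnalyticAt (S : EHoloAt T c k) : EAnalyticAt T c k := fun X φ hφ =>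
  analyticOn_Icc_of_comp_ofReal S.isOpen (S.holo X φ hφ) (fun _ ht => S.mem_U ht) (S.eq X φ hφ)

/-- **p. 263 «It is a C^∞-function of g_{j−1} ∈ [0, γ]» at the new index, DERIVED**: `B12BetaSmooth.ESmoothAt T c k`. [cite: Balaban1987RG1, p.263 (clause before (1.18))] -/
theorem eSmoothAt (S : EHoloAt T c k) : ESmoothAt T c k := fun X φ hφ n =>
  contDiffOn_Icc_of_comp_ofReal S.isOpen (S.holo X φ hφ) (fun _ ht => S.mem_U ht) (S.eq X φ hφ) n

/-- **(1.18) FOR ALL g-DERIVATIVES at the new index, DERIVED with explicit constants** (the new-index slice of the located open input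
`B12BetaSmooth.EDerivBound118`, unprinted as such): `‖∂ⁿ_g E^{(k+1)}(X, g, φ)‖ ≤ n! · E₀ · r⁻ⁿ · e^{−κ d_{k+1}(X)}` on `[0, γ]` (derivatives
within `[0, γ]`, `γ > 0`) — Cauchy's estimate in the coupling. [cite: Balaban1987RG1, (1.18) p.263 with p.266 (analytic alternative)] -/
theorem eDerivBoundAt (hγ : 0 < c.γ) (S : EHoloAt T c k) (n : ℕ) (X : (T.sys (k + 1)).Dom) (φ : Φ)
    (hφ : φ ∈ T.space (k + 1) X c.α₀ c.α₁) {t : ℝ} (ht : t ∈ Set.Icc (0 : ℝ) c.γ) :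
    ‖iteratedDerivWithin n (fun g => T.E (k + 1) X g φ) (Set.Icc 0 c.γ) t‖ ≤
      n.factorial * S.E₀ / S.r ^ n * Real.exp (-c.κ * (T.sys (k + 1)).dj X) := by
  have h := norm_iteratedDerivWithin_Icc_le (f := fun g => T.E (k + 1) X g φ) S.isOpen (S.holo X φ hφ) hγ
    (S.eq X φ hφ) S.r_pos S.ball_subset (S.bound X φ hφ) n ht
  calc ‖iteratedDerivWithin n (fun g => T.E (k + 1) X g φ) (Set.Icc 0 c.γ) t‖
      ≤ n.factorial * (S.E₀ * Real.exp (-c.κ * (T.sys (k + 1)).dj X)) / S.r ^ n := h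
    _ = n.factorial * S.E₀ / S.r ^ n * Real.exp (-c.κ * (T.sys (k + 1)).dj X) := by ring

/-- **The cumulative step for `B12BetaSmooth.EDerivBound118`**: the located input for the terms `1, …, k` with constants `E₀,ₙ`
dominating `n! · E₀ · r⁻ⁿ`, plus a holomorphic new term, give it for the terms `1, …, k+1`. [cite: Balaban1987RG1, (1.18) p.263 with p.266] -/
theorem eDerivBound118_succ (hγ : 0 < c.γ) (S : EHoloAt T c k) {E₀n : ℕ → ℝ} (hk : EDerivBound118 T c E₀n k)
    (hE : ∀ n : ℕ, n.factorial * S.E₀ / S.r ^ n ≤ E₀n n) : EDerivBound118 T c E₀n (k + 1) := by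
  intro j h1 hj n X φ hφ g hg
  rcases Nat.lt_or_ge j (k + 1) with hj' | hj'
  · exact hk j h1 (Nat.lt_succ_iff.mp hj') n X φ hφ g hg
  · have : j = k + 1 := le_antisymm hj hj'
    subst this
    exact (S.eDerivBoundAt hγ n X φ hφ hg).trans
      (mul_le_mul_of_nonneg_right (hE n) (Real.exp_pos _).le)

end EHoloAt

end Terms

/-! ## Part 4 (v3, append-only). The named transfer Prop, and the continuity ∕ Lipschitz forms of the β-clause on `[0, γ]` -/

section Transfer

variable {P : Params} {G : Type*} [GaugeGroup G] {Φ 𝒢 : Type*} {T : SFTower P G Φ 𝒢} {c : SFConsts} {k : ℕ}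

/-- **`B12BetaSmooth.PolarizationDerivTransfer T c E₀n k` HOLDS at every step carrying a holomorphic Π-source** (for every sequence of
constants `E₀n`): its conclusion `Nonempty (B12BetaSmooth.PiSmoothSource T c k)` is `PiHoloSource.toPiSmoothSource` outright — the
g-derivative hypotheses `ESmoothHyp`∕`EDerivBound118` of the named Prop are not needed in the «(or analytic)» alternative (Cauchy's estimates
replace them).  With it `B12BetaSmooth.betaClauses_of_transfer` applies verbatim. [cite: Balaban1987RG1, (1.20)–(1.21) p.264 with p.266 (analytic alternative)] -/
theorem polarizationDerivTransfer_of_piHolo (hγ : 0 < c.γ) (S : PiHoloSource T c k) (E₀n : ℕ → ℝ) :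
    PolarizationDerivTransfer T c E₀n k :=
  fun _ _ => ⟨S.toPiSmoothSource hγ⟩

/-- **Continuity of `β_{k+1}` on `[0, γ]`** (the qualitative half of the p. 264 clause that the flow step ∕ shooting argument consumes, cf.
`Step.flow_exists_of_betaBounds`; Markov typing: the last coupling only). [cite: Balaban1987RG1, p.264 (β-clause after (1.22))] -/
theorem PiHoloSource.betaContinuousOn (hγ : 0 < c.γ) (S : PiHoloSource T c k) :
    ContinuousOn (T.flow.β (k + 1)) (Set.Icc 0 c.γ) :=
  (S.betaSmoothAt hγ 0).continuousOn

/-- **Lipschitz form of the β-clause on `[0, γ]` with an explicit, k-uniform constant**: `|β_{k+1}(g) − β_{k+1}(g′)| ≤ (betaPrime510 d C δ₁ ∕ r) ·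
|g − g′|` for `g, g′ ∈ [0, γ]` (mean value inequality on the convex set `[0, γ]` + the first Cauchy bound `betaDerivBounds … 1`).
[cite: Balaban1987RG1, p.264 (β-clause after (1.22): «uniformly bounded … together with all derivatives»)] -/
theorem PiHoloSource.betaLipschitzOn (hγ : 0 < c.γ) (S : PiHoloSource T c k) {g g' : ℝ} (hg : g ∈ Set.Icc (0 : ℝ) c.γ)
    (hg' : g' ∈ Set.Icc (0 : ℝ) c.γ) :
    |T.flow.β (k + 1) g - T.flow.β (k + 1) g'| ≤ B12Sec2to5.betaPrime510 S.d S.C S.δ₁ / S.r * |g - g'| := by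
  have h1 : ContDiffOn ℝ 1 (T.flow.β (k + 1)) (Set.Icc 0 c.γ) := by exact_mod_cast S.betaSmoothAt hγ 1
  have hdiff : DifferentiableOn ℝ (T.flow.β (k + 1)) (Set.Icc 0 c.γ) := h1.differentiableOn one_ne_zero
  have hbound : ∀ x ∈ Set.Icc (0 : ℝ) c.γ,
      ‖derivWithin (T.flow.β (k + 1)) (Set.Icc 0 c.γ) x‖ ≤ B12Sec2to5.betaPrime510 S.d S.C S.δ₁ / S.r := by
    intro x hx
    have h := S.betaDerivBounds hγ 1 x hx
    rw [iteratedDerivWithin_one] at h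
    rw [Real.norm_eq_abs]
    calc |derivWithin (T.flow.β (k + 1)) (Set.Icc 0 c.γ) x|
        ≤ (Nat.factorial 1 : ℝ) * B12Sec2to5.betaPrime510 S.d S.C S.δ₁ / S.r ^ 1 := h
      _ = B12Sec2to5.betaPrime510 S.d S.C S.δ₁ / S.r := by simp
  have h := (convex_Icc (0 : ℝ) c.γ).norm_image_sub_le_of_norm_derivWithin_le hdiff hbound hg' hg
  rw [Real.norm_eq_abs, Real.norm_eq_abs] at h
  exact h

end Transfer

/-! ## Part 5 (v4, append-only). The endpoint `g = 0` by continuity, and the step deliverable from ]0, γ]-deliverables -/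

section Endpoint

variable {P : Params} {G : Type*} [GaugeGroup G] {Φ 𝒢 : Type*} {T : SFTower P G Φ 𝒢} {c : SFConsts} {k : ℕ}

/-- **(1.18) on the CLOSED interval from the half-open one by continuity at `g = 0`.**  If a g-uniform bound `‖E^{(k+1)}(X, g, φ)‖ ≤
B(X)` holds for `g ∈ ]0, γ]` (where [II] works: Lemma 2 p. 11 needs `g_k ≠ 0`) and `g ↦ E^{(k+1)}(X, g, φ)` is continuous at `0` within
`[0, γ]` (`γ > 0`), the bound holds on `[0, γ]` — the currency of `Step.SFHyp.bound118` ∕ p. 263 *«g_{j−1} ∈ [0, γ]»*.  (Limit of the bound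
along `𝓝[]0, γ]] 0`, which is non-trivial since `closure ]0, γ] = [0, γ]`.) [cite: Balaban1987RG1, (1.18) p.263 with (2.13) p.268 («vanishes at g_k = 0»)] -/
theorem bound118_Icc_of_Ioc (hγ : 0 < c.γ) {B : (T.sys (k + 1)).Dom → ℝ}
    (hIoc : ∀ X g φ, 0 < g → g ≤ c.γ → φ ∈ T.space (k + 1) X c.α₀ c.α₁ → ‖T.E (k + 1) X g φ‖ ≤ B X)
    (hcont : ∀ X φ, φ ∈ T.space (k + 1) X c.α₀ c.α₁ →
      ContinuousWithinAt (fun g => T.E (k + 1) X g φ) (Set.Icc 0 c.γ) 0) :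
    ∀ X g φ, 0 ≤ g → g ≤ c.γ → φ ∈ T.space (k + 1) X c.α₀ c.α₁ → ‖T.E (k + 1) X g φ‖ ≤ B X := by
  intro X g φ hg0 hgγ hφ
  rcases hg0.eq_or_lt with h | h
  · subst h
    have ht : Tendsto (fun g => T.E (k + 1) X g φ) (𝓝[Set.Ioc 0 c.γ] 0) (𝓝 (T.E (k + 1) X 0 φ)) :=
      (hcont X φ hφ).tendsto.mono_left (nhdsWithin_mono _ Set.Ioc_subset_Icc_self)
    haveI : (𝓝[Set.Ioc (0 : ℝ) c.γ] (0 : ℝ)).NeBot := by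
      rw [← mem_closure_iff_nhdsWithin_neBot, closure_Ioc hγ.ne]
      exact ⟨le_rfl, hγ.le⟩
    refine le_of_tendsto ht.norm ?_
    filter_upwards [self_mem_nhdsWithin] with g hg using hIoc X g φ hg.1 hg.2 hφ
  · exact hIoc X g φ h hgγ hφ

/-- Continuity of the new term in the coupling at every point of `[0, γ]` (within `[0, γ]`), from a holomorphic source `EHoloAt`. [cite: Balaban1987RG1, p.263 («C^∞-function of g_{j−1} ∈ [0, γ]»)] -/
theorem EHoloAt.continuousWithinAt (S : EHoloAt T c k) {X : (T.sys (k + 1)).Dom} {φ : Φ}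
    (hφ : φ ∈ T.space (k + 1) X c.α₀ c.α₁) {t : ℝ} (ht : t ∈ Set.Icc (0 : ℝ) c.γ) :
    ContinuousWithinAt (fun g => T.E (k + 1) X g φ) (Set.Icc 0 c.γ) t :=
  (S.eSmoothAt X φ hφ 0).continuousOn.continuousWithinAt ht

/-- **THE PER-STEP DELIVERABLE FROM [II] ON ]0, γ] ONLY** (no separate `g = 0` datum): [II]'s delivered clauses `B13.Deliverables (S g) c13` at
every coupling `g ∈ ]0, γ]` (Lemma 2 p. 11: `g_k ≠ 0`) in the representation (I.1.6) (`Δ.F g = (S g).Etot`), the dictionary with the algebraic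
clauses at every `g`, the constant comparison, (2.15), the gauge invariance of the spaces (p. 263), a holomorphic source for the new TERM
(`EHoloAt`: continuity at `g = 0` closes the interval, `bound118_Icc_of_Ioc`) and one for the polarization KERNEL (`PiHoloSource`: both β-clauses)
⇒ `Step.SFNewTerm T c k`. [cite: Balaban1988RG2Cluster, pp.21–22; Balaban1987RG1, (1.18) p.263, p.266 (analytic alternative)] -/
theorem sfNewTerm_of_deliverables_Ioc {S₂ : ℝ → B13.StepData} {c13 : B13.Consts} (Δ : StepDict T c k S₂)
    (hF : ∀ g, Δ.F g = (S₂ g).Etot) (hc : ConstsCompare c13 c)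
    (hdel : ∀ g, 0 < g → g ≤ c.γ → B13.Deliverables (S₂ g) c13)
    (hrepr : ∀ g, (S₂ g).Repr17) (hgauge : ∀ g X, (S₂ g).GaugeInv ((S₂ g).Etot X))
    (hrg : 1 / (T.flow.g k) ^ 2 = 1 / (T.flow.g (k + 1)) ^ 2 + T.flow.β (k + 1) (T.flow.g k))
    (hsp : SpacesGaugeInvariant T c (k + 1)) (hγ : 0 < c.γ) (E : EHoloAt T c k) (S : PiHoloSource T c k) :
    SFNewTerm T c k where
  rg := hrg
  localDep := localDep_of_dict Δ hrepr
  bound118 := bound118_Icc_of_Ioc hγ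
    (fun X g φ hg hgγ hφ => by
      have hb : B13.Bound118 (S₂ g).Dk1 (S₂ g).sp2 (Δ.F g) c13.E₀ c13.κ := by
        rw [hF g]; exact (hdel g hg hgγ).bound
      exact bound118_transport (fun X' => T.space (k + 1) X' c.α₀ c.α₁) (S₂ g).sp2 (fun X' φ' => T.E (k + 1) X' g φ')
        (Δ.F g) (Δ.ιX g) (Δ.ιφ g) hc.E₀_le hc.E₀_nonneg hc.κ_le hc.κ_nonneg (Δ.dj_le g) (Δ.mem_sp2 g)
        (fun X' φ' _ => Δ.E_eq g X' φ') hb X φ hφ)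
    (fun X φ hφ => E.continuousWithinAt hφ ⟨le_rfl, hγ.le⟩)
  spaceInv := hsp
  gaugeInv119 := gaugeInv119_of_dict Δ (fun g X => by rw [hF g]; exact hgauge g X)
  betaSmooth := S.betaSmoothAt hγ
  betaBound := S.betaBound

end Endpoint

end Literature.MathematicalPhysics.QuantumFieldTheory.Balaban1983to89.B12BetaHolo

end
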